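import Literature.NumberTheory.NumberFields.ClassFieldsOfIndexThree
import Literature.NumberTheory.NumberFields.ClassFieldsOfCharactersUniqueness
import Literature.NumberTheory.NumberFields.BaseAutomorphismTransport
import Literature.NumberTheory.QuadraticFields.ConjugateIdealClass
import Mathlib.FieldTheory.Galois.GaloisClosure
import HarnessLib

/-!
# The class fields of a quadratic field are normal over `ℚ`, and `Gal(K/ℚ)` acts on them by inversion

Topic `NumberTheory/QuadraticFields`.  Theorem-only file (no definition, no named fact).

Let `K` be a number field Galois over `ℚ`, `K̄ = AlgebraicClosure K`, and let `E ⊆ K̄` carry **class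
field data** for a character `ψ` of `Cl(𝓞_K)`: `E/K` finite Galois, unramified at all finite primes,
with an injective character `χ` of `Gal(E/K)` such that `χ(Frob_𝔔) = ψ([v])` for every Frobenius at
every prime `𝔔 ∣ v` (the output of the tree's `exists_classField_char_frobenius`,
`exists_isCubicClassField`).  For `g ∈ Aut(K̄/ℚ)` with `g|_K = τ` the conjugate field `g(E)` carries
class field data for the character `ψ ∘ τ⁻¹` (`exists_conj_frobData`: conjugate primes have conjugate
Frobenius elements, `Literature/NumberTheory/NumberFields/BaseAutomorphismTransport.lean`), and a field
carrying class field data for a character with the SAME kernel as `ψ` has, up to finitely many primes,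
the same completely split primes as `E` (`{v : ψ([v]) = 1}`), hence equals `E` by Bauer's theorem
(`eq_of_frobData`).

For a **quadratic** field `K` the non-trivial automorphism acts on the prime classes by inversion
(`mk0_mul_mk0_smul_eq_one`), so `ker (ψ ∘ τ⁻¹) = ker ψ^{-1} = ker ψ` and therefore:

* `conj_eq_of_frobData`, `apply_mem_of_frobData` — **`g(E) = E` for every `g ∈ Aut(K̄/ℚ)`**: the
  class fields of a quadratic field are normal over `ℚ` (Washington, *Cyclotomic Fields*, proof of
  Thm. 10.10; Cox, *Primes of the form x²+ny²*, Lemma 9.3 for the ring class fields: "`L` is Galois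
  over `ℚ` … the nontrivial element of `Gal(K/ℚ)` acts on `Gal(L/K)` by sending `σ` to `σ⁻¹`");
* `apply_apply_eq_symm_apply_of_frobData` — **the lifts of the non-trivial element of `Gal(K/ℚ)` act
  on `Gal(E/K)` by inversion**: `g(h(y)) = h⁻¹(g(y))` for `y ∈ E`, `h ∈ Aut(K̄/K)`, `g|_K ≠ 1`
  (generalised dihedral, Cox Lemma 9.3), because `χ(g Frob_v g⁻¹) = ψ([τv]) = ψ([v])⁻¹` and every
  element of `Gal(E/K)` is a Frobenius.

These are the normality/dihedral inputs of Scholz's reflection theorem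
(`Literature.NumberTheory.QuadraticFields.Scholz1932_reflection`).

## References

* D. A. Cox, *Primes of the form x² + ny²*, 2nd ed. (2013), §9.A, Lemma 9.3. [Cox2013]
* L. C. Washington, *Introduction to Cyclotomic Fields*, GTM 83 (1997), Thm. 10.10 (proof).
  [Washington1997]
* J. Neukirch, *Algebraic Number Theory* (1999), Ch. I §9; Ch. VII (13.9)–(13.10). [NeukirchANT1999]
-/

noncomputable section

open NumberField IsDedekindDomain Filter
open scoped nonZeroDivisors Pointwise

namespace Literature.NumberTheory.QuadraticFields

open Literature.NumberTheory.NumberFields Literature.NumberTheory.GaloisRepresentations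

variable {K : Type} [Field K] [NumberField K]

/-! ### The pointwise splitting law of class field data -/

/-- **Splitting law, prime by prime**: if `χ` is an injective character of `Gal(E/K)` with
`χ(Frob_𝔔) = ψ([v])` for all Frobenius elements, then a prime `v` unramified in `E` splits completely
iff `ψ([v]) = 1` (Cox Cor. 5.24; only unramifiedness at `v` itself is used).
[cite: Cox2013, §5.C Cor. 5.24] -/
theorem mem_splitPrimes_iff_eq_one_of_frobData {E : Type} [Field E] [NumberField E] [Algebra K E]
    [IsGalois K E] {ψ : ClassGroup (𝓞 K) →* ℂˣ} {χ : (E ≃ₐ[K] E) →* ℂˣ}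
    (hχ : Function.Injective χ)
    (hfrob : ∀ (v : HeightOneSpectrum (𝓞 K)) (Q : Ideal (𝓞 E)), Q ∈ v.asIdeal.primesOver (𝓞 E) →
      ∀ φ : E ≃ₐ[K] E, IsArithFrobAt (𝓞 K) φ Q →
        χ φ = ψ (ClassGroup.mk0 ⟨v.asIdeal, asIdeal_mem_nonZeroDivisors v⟩))
    {v : HeightOneSpectrum (𝓞 K)} (hunr : Algebra.IsUnramifiedIn (𝓞 E) v.asIdeal) :
    v ∈ splitPrimes K E ↔ ψ (ClassGroup.mk0 ⟨v.asIdeal, asIdeal_mem_nonZeroDivisors v⟩) = 1 := by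
  obtain ⟨Q, hQ, hφ⟩ := galFrob_spec K E v
  rw [mem_splitPrimes_iff_galFrob_eq_one hunr, ← hfrob v Q hQ _ hφ]
  constructor
  · intro h
    rw [h, map_one]
  · intro h
    exact hχ (by rw [h, map_one])

/-! ### Class field data on a conjugate field -/

section Conj

variable [IsGalois ℚ K] {g : AlgebraicClosure K ≃ₐ[ℚ] AlgebraicClosure K}
  {E E' : IntermediateField K (AlgebraicClosure K)} (hE' : ∀ x, x ∈ E' ↔ g.symm x ∈ E)

omit [IsGalois ℚ K] in
/-- The conjugate of a nonzero prime of `K` is prime. [folklore] -/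
theorem isPrime_smul_asIdeal (τ : K ≃ₐ[ℚ] K) (v : HeightOneSpectrum (𝓞 K)) :
    (τ • v.asIdeal).IsPrime := by
  haveI := v.isPrime
  exact Ideal.IsPrime.smul τ

include hE' in
/-- **Class field data on the conjugate field** (Neukirch I §9: `Frob_{g𝔔} = g Frob_𝔔 g⁻¹`): if
`E ⊆ K̄` carries class field data `(ψ, χ)` and `g ∈ Aut(K̄/ℚ)` restricts to `τ` on `K`, then along
the `τ`-semilinear isomorphism `e = g|_E : E ≃ g(E)` and the induced isomorphism `c : σ ↦ e σ e⁻¹` of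
Galois groups, every Frobenius `φ'` of `g(E)/K` at a prime above `v` satisfies
`χ(c⁻¹ φ') = ψ([τ⁻¹ v])`; i.e. `g(E)` carries class field data `(ψ ∘ τ⁻¹, χ ∘ c⁻¹)`.
[cite: NeukirchANT1999, Ch. I §9] -/
theorem exists_conj_frobData [FiniteDimensional K E] [IsGalois K E] {ψ : ClassGroup (𝓞 K) →* ℂˣ}
    {χ : (E ≃ₐ[K] E) →* ℂˣ}
    (hfrob : ∀ (v : HeightOneSpectrum (𝓞 K)) (Q : Ideal (𝓞 E)), Q ∈ v.asIdeal.primesOver (𝓞 E) →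
      ∀ φ : E ≃ₐ[K] E, IsArithFrobAt (𝓞 K) φ Q →
        χ φ = ψ (ClassGroup.mk0 ⟨v.asIdeal, asIdeal_mem_nonZeroDivisors v⟩)) :
    ∃ (e : E ≃+* E') (c : (E ≃ₐ[K] E) ≃* (E' ≃ₐ[K] E')),
      (∀ y : E, ((e y : E') : AlgebraicClosure K) = g y) ∧
      (∀ (σ : E ≃ₐ[K] E) (y : E), c σ (e y) = e (σ y)) ∧
      ∀ (v : HeightOneSpectrum (𝓞 K)) (Q' : Ideal (𝓞 E')), Q' ∈ v.asIdeal.primesOver (𝓞 E') →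
        ∀ φ' : E' ≃ₐ[K] E', IsArithFrobAt (𝓞 K) φ' Q' →
          χ (c.symm φ') = ψ (ClassGroup.mk0 ⟨(g.restrictNormal K).symm • v.asIdeal,
            smul_asIdeal_mem_nonZeroDivisors _ v⟩) := by
  classical
  haveI : FiniteDimensional K E' := finiteDimensional_conj hE'
  haveI : IsGalois K E' := isGalois_conj hE'
  obtain ⟨e, he, heK⟩ := exists_ringEquiv_conj hE'
  set τ : K ≃ₐ[ℚ] K := g.restrictNormal K with hτdef
  obtain ⟨c, hcinj, hc⟩ := exists_conjHom_of_semilinear τ.toRingEquiv e heK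
  -- `c` is bijective: both Galois groups have `[E:K] = [g(E):K]` elements
  have hcard : Nat.card (E' ≃ₐ[K] E') ≤ Nat.card (E ≃ₐ[K] E) := by
    rw [IsGalois.card_aut_eq_finrank, IsGalois.card_aut_eq_finrank, finrank_conj hE']
  have hbij : Function.Bijective c := hcinj.bijective_of_nat_card_le hcard
  let cE : (E ≃ₐ[K] E) ≃* (E' ≃ₐ[K] E') := MulEquiv.ofBijective c hbij
  refine ⟨e, cE, he, hc, ?_⟩
  intro v Q' hQ' φ' hφ'
  set σ : E ≃ₐ[K] E := cE.symm φ' with hσdef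
  have hφσ : φ' = c σ := (MulEquiv.apply_symm_apply cE φ').symm
  -- `e⁻¹` is `τ⁻¹`-semilinear and conjugates `φ'` back to `σ`
  have heK' : ∀ x, e.symm (algebraMap K E' x) = algebraMap K E (τ.toRingEquiv.symm x) :=
    symm_algebraMap_of_semilinear τ.toRingEquiv e heK
  have hσe : ∀ y', σ (e.symm y') = e.symm (φ' y') := by
    intro y'
    apply e.injective
    rw [← hc, e.apply_symm_apply, e.apply_symm_apply, hφσ]
  -- so `σ` is a Frobenius of `E/K` at `e⁻¹(Q')`, a prime above `τ⁻¹ v`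
  have hfrobσ : IsArithFrobAt (𝓞 K) σ (Q'.map (RingOfIntegers.mapRingEquiv e.symm)) :=
    isArithFrobAt_map_of_semilinear τ.toRingEquiv.symm e.symm heK' φ' σ hσe hφ'
  have hQ : Q'.map (RingOfIntegers.mapRingEquiv e.symm) ∈
      (v.asIdeal.map (RingOfIntegers.mapRingEquiv τ.toRingEquiv.symm)).primesOver (𝓞 E) :=
    map_mem_primesOver_of_semilinear τ.toRingEquiv.symm e.symm heK' hQ'
  let w : HeightOneSpectrum (𝓞 K) :=
    ⟨τ.symm • v.asIdeal, isPrime_smul_asIdeal τ.symm v,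
      mem_nonZeroDivisors_iff_ne_zero.mp (smul_asIdeal_mem_nonZeroDivisors τ.symm v)⟩
  have hw : v.asIdeal.map (RingOfIntegers.mapRingEquiv τ.toRingEquiv.symm) = w.asIdeal := by
    change _ = τ.symm • v.asIdeal
    rw [smul_eq_map_mapRingEquiv]
    rfl
  rw [hw] at hQ
  exact hfrob w _ hQ σ hfrobσ

end Conj

/-! ### Class field data with the same kernel determine the field (Bauer) -/

/-- **A field carrying class field data is determined by `ker ψ`**: if `E, E' ⊆ K̄` are finite Galois
over `K`, `E` is unramified at all finite primes, and they carry class field data `(ψ, χ)`, `(ψ', χ')`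
with `ker ψ = ker ψ'`, then `E' = E`.  Indeed off the finitely many primes ramified in `E'` both have
the completely split primes `{v : [v] ∈ ker ψ}` (`mem_splitPrimes_iff_eq_one_of_frobData`), so they
coincide by Bauer's theorem (`eq_of_splitPrimes_eventuallyEq`, applied inside the compositum `E E'`).
[cite: NeukirchANT1999, Ch. VII Cor. (13.10)] -/
theorem eq_of_frobData {E E' : IntermediateField K (AlgebraicClosure K)} [FiniteDimensional K E]
    [IsGalois K E] [FiniteDimensional K E'] [IsGalois K E']
    (hunr : ∀ v : HeightOneSpectrum (𝓞 K), Algebra.IsUnramifiedIn (𝓞 E) v.asIdeal)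
    {ψ : ClassGroup (𝓞 K) →* ℂˣ} {χ : (E ≃ₐ[K] E) →* ℂˣ} (hχ : Function.Injective χ)
    (hfrob : ∀ (v : HeightOneSpectrum (𝓞 K)) (Q : Ideal (𝓞 E)), Q ∈ v.asIdeal.primesOver (𝓞 E) →
      ∀ φ : E ≃ₐ[K] E, IsArithFrobAt (𝓞 K) φ Q →
        χ φ = ψ (ClassGroup.mk0 ⟨v.asIdeal, asIdeal_mem_nonZeroDivisors v⟩))
    {ψ' : ClassGroup (𝓞 K) →* ℂˣ} {χ' : (E' ≃ₐ[K] E') →* ℂˣ} (hχ' : Function.Injective χ')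
    (hfrob' : ∀ (v : HeightOneSpectrum (𝓞 K)) (Q : Ideal (𝓞 E')), Q ∈ v.asIdeal.primesOver (𝓞 E') →
      ∀ φ : E' ≃ₐ[K] E', IsArithFrobAt (𝓞 K) φ Q →
        χ' φ = ψ' (ClassGroup.mk0 ⟨v.asIdeal, asIdeal_mem_nonZeroDivisors v⟩))
    (hker : ψ.ker = ψ'.ker) : E' = E := by
  classical
  haveI : NumberField E := NumberField.of_module_finite K E
  haveI : NumberField E' := NumberField.of_module_finite K E'
  -- the split primes agree off the primes ramified in `E'`
  have hev : ∀ᶠ v : HeightOneSpectrum (𝓞 K) in cofinite,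
      (v ∈ splitPrimes K E ↔ v ∈ splitPrimes K E') := by
    rw [Filter.eventually_cofinite]
    refine (finite_setOf_not_isUnramifiedIn K E').subset fun v hv => ?_
    simp only [Set.mem_setOf_eq] at hv ⊢
    intro hunr'
    apply hv
    rw [mem_splitPrimes_iff_eq_one_of_frobData hχ hfrob (hunr v),
      mem_splitPrimes_iff_eq_one_of_frobData hχ' hfrob' hunr', ← MonoidHom.mem_ker,
      ← MonoidHom.mem_ker, hker]
  -- Bauer, inside the finite Galois extension `E ⊔ E'` of `K`
  haveI : NumberField (E ⊔ E' : IntermediateField K (AlgebraicClosure K)) :=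
    NumberField.of_module_finite K _
  set E₁ : IntermediateField K (E ⊔ E' : IntermediateField K (AlgebraicClosure K)) :=
    IntermediateField.restrict (le_sup_left : E ≤ E ⊔ E') with hE₁
  set E₂ : IntermediateField K (E ⊔ E' : IntermediateField K (AlgebraicClosure K)) :=
    IntermediateField.restrict (le_sup_right : E' ≤ E ⊔ E') with hE₂
  let f₁ : E ≃ₐ[K] E₁ := IntermediateField.restrict_algEquiv _
  let f₂ : E' ≃ₐ[K] E₂ := IntermediateField.restrict_algEquiv _
  haveI : FiniteDimensional K E₁ := LinearEquiv.finiteDimensional f₁.toLinearEquiv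
  haveI : FiniteDimensional K E₂ := LinearEquiv.finiteDimensional f₂.toLinearEquiv
  haveI : IsGalois K E₁ := IsGalois.of_algEquiv f₁
  haveI : IsGalois K E₂ := IsGalois.of_algEquiv f₂
  haveI : NumberField E₁ := NumberField.of_module_finite K E₁
  haveI : NumberField E₂ := NumberField.of_module_finite K E₂
  have h₁ : splitPrimes K E₁ = splitPrimes K E :=
    (Literature.NumberTheory.EllipticCurves.splitPrimes_eq_of_algEquiv f₁).symm
  have h₂ : splitPrimes K E₂ = splitPrimes K E' :=
    (Literature.NumberTheory.EllipticCurves.splitPrimes_eq_of_algEquiv f₂).symm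
  have h12 : E₁ = E₂ := by
    apply eq_of_splitPrimes_eventuallyEq E₁ E₂
    refine hev.mono fun v hv => ?_
    rw [h₁, h₂]
    exact hv
  calc E' = IntermediateField.lift E₂ := (IntermediateField.lift_restrict _).symm
    _ = IntermediateField.lift E₁ := by rw [h12]
    _ = E := IntermediateField.lift_restrict _

/-! ### Quadratic base field: normality over `ℚ` and the dihedral action -/

section Quadratic

variable [IsGalois ℚ K] (h2 : Module.finrank ℚ K = 2)
  {E : IntermediateField K (AlgebraicClosure K)} [FiniteDimensional K E] [IsGalois K E]
  (hunr : ∀ v : HeightOneSpectrum (𝓞 K), Algebra.IsUnramifiedIn (𝓞 E) v.asIdeal)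
  {ψ : ClassGroup (𝓞 K) →* ℂˣ} {χ : (E ≃ₐ[K] E) →* ℂˣ} (hχ : Function.Injective χ)
  (hfrob : ∀ (v : HeightOneSpectrum (𝓞 K)) (Q : Ideal (𝓞 E)), Q ∈ v.asIdeal.primesOver (𝓞 E) →
    ∀ φ : E ≃ₐ[K] E, IsArithFrobAt (𝓞 K) φ Q →
      χ φ = ψ (ClassGroup.mk0 ⟨v.asIdeal, asIdeal_mem_nonZeroDivisors v⟩))

include h2 hunr hχ hfrob in
/-- **The class fields of a quadratic field are normal over `ℚ`**: if `K` is quadratic and `E ⊆ K̄`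
carries class field data `(ψ, χ)`, then `g(E) = E` for every `g ∈ Aut(K̄/ℚ)`.  The conjugate `g(E)`
carries the data `(ψ ∘ τ⁻¹, χ ∘ c⁻¹)` (`exists_conj_frobData`), and `ψ ∘ τ⁻¹ ∈ {ψ, ψ⁻¹}` because the
non-trivial automorphism of `K` inverts the prime classes (`mk0_mul_mk0_smul_eq_one`); both have kernel
`ker ψ`, so `g(E) = E` by `eq_of_frobData` (Cox Lemma 9.3; Washington, proof of Thm. 10.10).
[cite: Cox2013, §9.A Lemma 9.3] -/
theorem conj_eq_of_frobData (g : AlgebraicClosure K ≃ₐ[ℚ] AlgebraicClosure K)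
    {E' : IntermediateField K (AlgebraicClosure K)} (hE' : ∀ x, x ∈ E' ↔ g.symm x ∈ E) :
    E' = E := by
  classical
  haveI : FiniteDimensional K E' := finiteDimensional_conj hE'
  haveI : IsGalois K E' := isGalois_conj hE'
  obtain ⟨e, c, -, -, hfrob'⟩ := exists_conj_frobData hE' hfrob
  set τ : K ≃ₐ[ℚ] K := g.restrictNormal K with hτdef
  have hχ' : Function.Injective (χ.comp c.symm.toMonoidHom) := hχ.comp c.symm.injective
  by_cases hτ : τ.symm = 1
  · -- `g` is trivial on `K`: `g(E)` carries the data `(ψ, χ ∘ c⁻¹)`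
    refine eq_of_frobData hunr hχ hfrob (ψ' := ψ) hχ' ?_ rfl
    intro v Q' hQ' φ' hφ'
    have hI : (⟨τ.symm • v.asIdeal, smul_asIdeal_mem_nonZeroDivisors _ v⟩ : (Ideal (𝓞 K))⁰) =
        ⟨v.asIdeal, asIdeal_mem_nonZeroDivisors v⟩ :=
      Subtype.ext (by change τ.symm • v.asIdeal = v.asIdeal; rw [hτ, one_smul])
    rw [MonoidHom.comp_apply, MulEquiv.coe_toMonoidHom, hfrob' v Q' hQ' φ' hφ', hI]
  · -- `g|_K = τ ≠ 1`: `[τ⁻¹ v] = [v]⁻¹`, so `g(E)` carries the data `(ψ⁻¹, χ ∘ c⁻¹)`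
    refine eq_of_frobData hunr hχ hfrob (ψ' := ψ⁻¹) hχ' ?_ ?_
    · intro v Q' hQ' φ' hφ'
      rw [MonoidHom.comp_apply, MulEquiv.coe_toMonoidHom, hfrob' v Q' hQ' φ' hφ',
        MonoidHom.inv_apply, ← map_inv]
      congr 1
      exact eq_inv_of_mul_eq_one_right (mk0_mul_mk0_smul_eq_one h2 τ.symm hτ v)
    · ext x
      rw [MonoidHom.mem_ker, MonoidHom.mem_ker, MonoidHom.inv_apply, inv_eq_one]

include h2 hunr hχ hfrob in
/-- **Normality over `ℚ`, membership form**: `g(E) ⊆ E` for every `g ∈ Aut(K̄/ℚ)` when `K` is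
quadratic and `E` carries class field data. [cite: Cox2013, §9.A Lemma 9.3] -/
theorem apply_mem_of_frobData (g : AlgebraicClosure K ≃ₐ[ℚ] AlgebraicClosure K)
    {x : AlgebraicClosure K} (hx : x ∈ E) : g x ∈ E := by
  obtain ⟨E', hE'⟩ := exists_intermediateField_conj g E
  have hEE := conj_eq_of_frobData h2 hunr hχ hfrob g hE'
  rw [← hEE, hE', g.symm_apply_apply]
  exact hx

include h2 hunr hχ hfrob in
/-- **`Gal(K/ℚ)` acts on `Gal(E/K)` by inversion** (generalised dihedral structure of `Gal(E/ℚ)`,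
Cox Lemma 9.3): if `K` is quadratic, `E` carries class field data, `g ∈ Aut(K̄/ℚ)` is non-trivial on
`K` and `h ∈ Aut(K̄/K)`, then `g(h(y)) = h⁻¹(g(y))` for all `y ∈ E`.  With `c(σ) = gσg⁻¹` on
`Gal(E/K)` one has `χ(c⁻¹φ) = ψ([τ⁻¹v]) = ψ([v])⁻¹ = χ(φ⁻¹)` for every Frobenius `φ = Frob_v`, and
every element of `Gal(E/K)` is a Frobenius (Chebotarev), so `c(σ) = σ⁻¹`.
[cite: Cox2013, §9.A Lemma 9.3] -/
theorem apply_apply_eq_symm_apply_of_frobData (g : AlgebraicClosure K ≃ₐ[ℚ] AlgebraicClosure K)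
    (hg : g.restrictNormal K ≠ 1) (h : AlgebraicClosure K ≃ₐ[K] AlgebraicClosure K)
    {y : AlgebraicClosure K} (hy : y ∈ E) : g (h y) = h.symm (g y) := by
  classical
  obtain ⟨E', hE'⟩ := exists_intermediateField_conj g E
  have hEE : E' = E := conj_eq_of_frobData h2 hunr hχ hfrob g hE'
  subst hEE
  haveI : NumberField E' := NumberField.of_module_finite K E'
  obtain ⟨e, c, he, hc, hfrob'⟩ := exists_conj_frobData hE' hfrob
  set τ : K ≃ₐ[ℚ] K := g.restrictNormal K with hτdef
  have hτ : τ.symm ≠ 1 := by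
    intro h1
    apply hg
    rw [← AlgEquiv.symm_symm τ, h1]
    rfl
  -- `c σ = σ⁻¹` for every `σ`: every `σ` is a Frobenius, and `χ (c⁻¹ φ) = ψ([τ⁻¹ v]) = χ(φ)⁻¹`
  have hcinv : ∀ φ : E' ≃ₐ[K] E', c.symm φ = φ⁻¹ := by
    intro φ
    obtain ⟨q, -, -, Q, hQ, hφQ⟩ :=
      (infinite_setOf_exists_isArithFrobAt (F := K) (L := E') φ).nonempty
    apply hχ
    rw [hfrob' q Q hQ φ hφQ, map_inv, hfrob q Q hQ φ hφQ, ← map_inv]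
    congr 1
    exact eq_inv_of_mul_eq_one_right (mk0_mul_mk0_smul_eq_one h2 τ.symm hτ q)
  have hcσ : ∀ σ : E' ≃ₐ[K] E', c σ = σ⁻¹ := by
    intro σ
    have h1 := hcinv (c σ)
    rw [MulEquiv.symm_apply_apply] at h1
    exact (inv_eq_iff_eq_inv.mpr h1).symm
  -- apply this to `σ = h|_E`
  set σ : E' ≃ₐ[K] E' := h.restrictNormal E' with hσdef
  have h1 : h y = ((σ ⟨y, hy⟩ : E') : AlgebraicClosure K) := by
    rw [hσdef, AlgEquiv.restrictNormal_apply]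
  have h2' : g ((σ ⟨y, hy⟩ : E') : AlgebraicClosure K) =
      ((σ⁻¹ (e ⟨y, hy⟩) : E') : AlgebraicClosure K) := by
    rw [← he, ← hc, hcσ]
  have h3 : h ((σ⁻¹ (e ⟨y, hy⟩) : E') : AlgebraicClosure K) = g y := by
    rw [← AlgEquiv.restrictNormal_apply E' h, ← hσdef]
    change ((σ (σ⁻¹ (e ⟨y, hy⟩)) : E') : AlgebraicClosure K) = g y
    rw [← AlgEquiv.mul_apply, mul_inv_cancel, AlgEquiv.one_apply, he]
  rw [h1, h2', ← h3, AlgEquiv.symm_apply_apply]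

end Quadratic

end Literature.NumberTheory.QuadraticFields

end
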